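import Literature.Analysis.FluidPDE.ReleaseLogBoundSmooth
import Literature.Analysis.FluidPDE.PassiveScalarClassicalEnergy

/-!
# G1 `stub_strainGate` — the strain gate of the line `Sketch` (crux stmt-AnomalousDissipation-0206)

Registered tool stub of the line `Sketch` (duhamel-release) for the crux
`Summit.AnomalousDissipation.AnomalousDissipation.Theses.TwoAndHalfD.TwohalfdThesis`
(stmt-AnomalousDissipation-0206): the NECESSARY CONDITION, in Navier–Stokes currency, that every design of
the line's open witness `stub_releasedMixingWitness` (W) must respect.

CONTENT (`strainGate_of_loss`, every dimension; `stub_strainGate` = the registered planar statement). For a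
smooth pattern `h` on `T^d` and a window length `τ₀ > 0` there are `κ₀ ∈ (0,1)` and `C ≥ 0`, depending only
on `sup |h|`, `sup ‖∇h‖`, `τ₀` (and `d`), such that for every diffusivity `0 < κ ≤ κ₀`, every classical
solution `φ` of `∂ₜφ + u·∇φ = κΔφ` on `[0, τ₀] × T^d` (smooth divergence-free drift `u`, part of the notion
`Torus.IsClassicalScalarTransportOn`) released from `φ 0 = h`, and every strain budget
`∫₀^{τ₀} ‖∇u(t)‖_{L²} dt ≤ S` (`∫⁻ (eGradNormSq (u t))^{1/2} ≤ ofReal S`):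

  `(‖h‖²_{L²} − ‖φ(τ₀)‖²_{L²}) · log(1/κ) ≤ C (S + 1)`.

So a loss of a fixed fraction `δ‖h‖²` of variance on a window of length `τ₀` costs window strain
`S ≥ (δ‖h‖²/C) log(1/κ) − 1`: uniformly-in-`ν` fast dissipation of ONE smooth datum forces logarithmically
divergent `L¹ₜL²ₓ` velocity gradients.  This strictly strengthens the landed log gate
`releaseEnvelope_false_of_gradient_bound` (`…StubLogGate.lean`, p91755: a `j`-uniform POINTWISE gradient bound
forbids any loss) from `L^∞` to `L¹ₜL²ₓ` gradients — the a-priori quantity of a Navier–Stokes drift (mean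
enstrophy) — and it is quantitative.

PROOF. The energy identity `‖h‖² − ‖φ(τ₀)‖² = 2κ∫₀^{τ₀}‖∇φ‖²`
(`IsClassicalScalarTransportOn.scalarL2Sq_add_scalarDissipation_holds`) and the tree's logarithmic dissipation
bound for releases at Sobolev level, smooth drifts (`Torus.releaseLogBound_smooth`, the two-point /
reversed-kernel form of the Crippa–De Lellis logarithmic estimate, Seis 2022 Lemma 3 / Rmk. 1):
`κ∫₀^{τ₀}‖∇φ‖² ≤ C(S+1)/log(1/κ)` (`eScalarDissipation_eq_ofReal` passes to reals).
Supports stmt-AnomalousDissipation-0206. [folklore: Crippa–De Lellis 2008 Thm. 2.1; Seis, CMP 399 (2023) Lemma 3]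
-/

noncomputable section

-- the summit path `AnomalousDissipation/AnomalousDissipation` duplicates a namespace component
set_option linter.dupNamespace false

namespace Summit.AnomalousDissipation.AnomalousDissipation.Theorems.TwohalfdThesis

open MeasureTheory Set Filter Topology
open scoped ENNReal NNReal InnerProductSpace
open Literature.Analysis.FunctionSpaces Literature.Analysis.FluidPDE

section General

variable {d : Type*} [Fintype d] [DecidableEq d]

omit [DecidableEq d] in
/-- A smooth scalar on the compact torus has bounded modulus and bounded gradient:
`∃ H L, |h| ≤ H ∧ ‖∇h‖ ≤ L`. [folklore] -/
theorem exists_abs_le_and_norm_gradient_le {h : UnitAddTorus d → ℝ} (hh : Torus.IsSmooth h) :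
    ∃ H L : ℝ, (∀ x, |h x| ≤ H) ∧ ∀ x, ‖Torus.gradient h x‖ ≤ L := by
  obtain ⟨H, hH⟩ :=
    hh.continuous.bounded_above_of_compact_support (HasCompactSupport.of_compactSpace h)
  obtain ⟨L, hL⟩ :=
    hh.gradient.continuous.bounded_above_of_compact_support (HasCompactSupport.of_compactSpace _)
  exact ⟨H, L, fun x => (Real.norm_eq_abs (h x)) ▸ hH x, hL⟩

/-- **The strain gate (every dimension).**  For a smooth pattern `h` on `T^d` and a window length
`τ₀ > 0` there are `κ₀ ∈ (0,1)` and `C ≥ 0` such that for `0 < κ ≤ κ₀`, every classical solution `φ` of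
`∂ₜφ + u·∇φ = κΔφ` on `[0, τ₀] × T^d` with `φ 0 = h` and every strain budget
`∫₀^{τ₀}‖∇u‖_{L²} ≤ S`: `(‖h‖² − ‖φ(τ₀)‖²)·log(1/κ) ≤ C(S+1)` — variance lost on the window costs
logarithmic `L¹ₜL²ₓ` strain (energy identity + the logarithmic dissipation bound for releases
`Torus.releaseLogBound_smooth`). [folklore] -/
theorem strainGate_of_loss {h : UnitAddTorus d → ℝ} (hh : Torus.IsSmooth h) {τ₀ : ℝ} (hτ₀ : 0 < τ₀) :
    ∃ κ₀ C : ℝ, 0 < κ₀ ∧ κ₀ < 1 ∧ 0 ≤ C ∧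
      ∀ (κ S : ℝ) (u : ℝ → UnitAddTorus d → EuclideanSpace ℝ d) (φ : ℝ → UnitAddTorus d → ℝ),
        0 < κ → κ ≤ κ₀ → 0 ≤ S →
        Torus.IsClassicalScalarTransportOn (Icc 0 τ₀) κ u φ → φ 0 = h →
        ∫⁻ t in Ioo 0 τ₀, Torus.eGradNormSq (u t) ^ (1 / 2 : ℝ) ≤ ENNReal.ofReal S →
        (Torus.scalarL2Sq h - Torus.scalarL2Sq (φ τ₀)) * Real.log κ⁻¹ ≤ C * (S + 1) := by
  obtain ⟨H, L, hH, hL⟩ := exists_abs_le_and_norm_gradient_le hh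
  obtain ⟨κ₀, C, hκ₀, hκ₀1, hC, hmain⟩ := Torus.releaseLogBound_smooth (d := d) H L τ₀ hτ₀
  refine ⟨κ₀, 2 * C, hκ₀, hκ₀1, by positivity, ?_⟩
  intro κ S u φ hκ hκκ₀ hS hφ hφ0 hstrain
  have hdis := hmain κ τ₀ S u h φ hκ hκκ₀ hτ₀ le_rfl hS hstrain hh hH hL hφ hφ0
  rw [Torus.eScalarDissipation_eq_ofReal hκ.le hτ₀ hφ] at hdis
  have hlog : 0 < Real.log κ⁻¹ := Real.log_pos ((one_lt_inv₀ hκ).2 (hκκ₀.trans_lt hκ₀1))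
  have hRHS : 0 ≤ C * (S + 1) / Real.log κ⁻¹ := by positivity
  have hsd : Torus.scalarDissipation κ φ 0 τ₀ ≤ C * (S + 1) / Real.log κ⁻¹ :=
    (ENNReal.ofReal_le_ofReal_iff hRHS).1 hdis
  have hsd' : Torus.scalarDissipation κ φ 0 τ₀ * Real.log κ⁻¹ ≤ C * (S + 1) :=
    (le_div_iff₀ hlog).1 hsd
  have henergy :=
    Torus.IsClassicalScalarTransportOn.scalarL2Sq_add_scalarDissipation_holds hφ hτ₀.le subset_rfl
  rw [hφ0] at henergy
  have hloss : Torus.scalarL2Sq h - Torus.scalarL2Sq (φ τ₀) = 2 * Torus.scalarDissipation κ φ 0 τ₀ := by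
    linarith
  rw [hloss]
  nlinarith

end General

/-- **G1 `stub_strainGate` (line `Sketch` = duhamel-release, crux `TwoAndHalfD.TwohalfdThesis`; registered
signature).**  Planar case of `strainGate_of_loss`: for a smooth pattern `h` on `T²` and `τ₀ > 0` there are
`κ₀ ∈ (0,1)`, `C ≥ 0` such that for `0 < κ ≤ κ₀`, every classical release `φ` of `h` into a smooth
divergence-free drift `u` on `[0, τ₀]` with strain budget `∫₀^{τ₀}‖∇u‖_{L²} ≤ S`:
`(‖h‖² − ‖φ(τ₀)‖²)·log(1/κ) ≤ C(S+1)`. [folklore] -/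
theorem stub_strainGate :
    ∀ (h : (UnitAddTorus (Fin 2)) → ℝ) (τ₀ : ℝ), Torus.IsSmooth h → 0 < τ₀ →
      ∃ κ₀ C : ℝ, 0 < κ₀ ∧ κ₀ < 1 ∧ 0 ≤ C ∧
        ∀ (κ S : ℝ) (u : ℝ → (UnitAddTorus (Fin 2)) → (EuclideanSpace ℝ (Fin 2))) (φ : ℝ → (UnitAddTorus (Fin 2)) → ℝ),
          0 < κ → κ ≤ κ₀ → 0 ≤ S →
          Torus.IsClassicalScalarTransportOn (Icc 0 τ₀) κ u φ → φ 0 = h →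
          ∫⁻ t in Ioo 0 τ₀, Torus.eGradNormSq (u t) ^ (1 / 2 : ℝ) ≤ ENNReal.ofReal S →
          (Torus.scalarL2Sq h - Torus.scalarL2Sq (φ τ₀)) * Real.log κ⁻¹ ≤ C * (S + 1) :=
  fun _h _τ₀ hh hτ₀ => strainGate_of_loss hh hτ₀

end Summit.AnomalousDissipation.AnomalousDissipation.Theorems.TwohalfdThesis

end
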